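import Literature.Topology.FourManifolds.KhBigonD
import HarnessLib

/-!
# Enhanced states of the bigon: the five blocks of the cancellation of the second move

Sibling file of `KhComplex.lean`, continuing `KhBigon`, `KhBigonD` in the invariance programme for
`Literature.Topology.FourManifolds.GaussDiagram.nonempty_iso_khovanovHomology_of_equiv`
(Khovanov (2000), Thm. 1; second Reidemeister move, §5.3; Bar-Natan (2002), §4.3). The cube of
the bigon `G.bigon m tf ε` over the square of its two new chords `f` (positive) and `g`
(negative) has the four corners

* `stA σ` (both `0`), `stO σ` (`f` flipped: the old resolution of `stA σ` with the small circle
  `O` split off), `stU σ` (both `1`: `O` merged back) and `stD σ` (the oriented resolution,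
  `= C(D)` by `KhBigonD`),

and the cancellation of Khovanov (2000), §5.3 / Bar-Natan (2002), §4.3 uses the basis of
enhanced states adapted to this: writing `X` for the enhanced states over the corners `stA σ`
(`XA`), the enhanced states of the bigon are

  `X ⊕ (X ⊗ {O ↦ X}) ⊕ (X ⊗ {O ↦ 1}) ⊕ X ⊕ C(D)` = `A ⊕ P ⊕ Q ⊕ U ⊕ D`,

through the bijections `embO x o` (push across the split at `f`, label `o` on `O`;
`KhSurgeryStates`), `embU x` (then push across the merge at `g`) and `bigonD` (`KhBigonD`). This
file constructs the bijection `bigonESEquiv` and computes the matrix blocks that the Gaussian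
elimination of `KhGaussElim` needs:

* `incidence_embA_embP` — **the block `A → P` (split off `O` labelled `X`) is the identity up to
  the Koszul sign**: `⟨d x, embO x' X⟩ = [x = x'] · edgeSign`;
* `incidence_embQ_embU` — **the block `Q → U` (merge `O` labelled `1`) is the identity up to the
  Koszul sign**;
* `incidence_eq_zero_of_label_sideM_ne` — the block `Q → P` vanishes (old chords do not touch
  `O`), and `incidence_eq_zero_of_state_true_false` — blocks against the direction of the cube
  vanish.

No named fact is introduced.

## References

* M. Khovanov, *A categorification of the Jones polynomial*, Duke Math. J. 101 (2000) 359–426,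
  §5.3. [cite: Khovanov2000, §5.3]
* D. Bar-Natan, *On Khovanov's categorification of the Jones polynomial*, Algebr. Geom. Topol. 2
  (2002) 337–370, §4.3. [cite: BarNatan2002, §4]
-/

open Function

noncomputable section

namespace Literature.Topology.FourManifolds

namespace GaussDiagram

variable (G : GaussDiagram) (m : Fin (2 * G.n + 1)) (tf : Bool) (ε : ℤˣ)

/-- Membership in the small circle is decidable. [folklore] -/
instance instDecidablePredInO : DecidablePred (G.InO m tf ε) := fun _ ↦ by
  unfold InO; infer_instance

/-! ## Sectors by the smoothings of the two new chords -/

/-- The old part of a state of the bigon. [folklore] -/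
def oldOf (τ : (G.bigon m tf ε).State) : G.State := fun i ↦ τ (G.oldC m tf ε i)

/-- The old part of a `bigonState`. [folklore] -/
@[simp] theorem oldOf_bigonState (σ : G.State) (a b : Bool) :
    G.oldOf m tf ε (G.bigonState m tf ε σ a b) = σ := funext fun i ↦ G.bigonState_oldC m tf ε σ a b i

/-- The old part of the all-`0` resolution. [folklore] -/
@[simp] theorem oldOf_stA (σ : G.State) : G.oldOf m tf ε (G.stA m tf ε σ) = σ := G.oldOf_bigonState m tf ε σ _ _
/-- The old part of the resolution with the small circle. [folklore] -/
@[simp] theorem oldOf_stO (σ : G.State) : G.oldOf m tf ε (G.stO m tf ε σ) = σ := G.oldOf_bigonState m tf ε σ _ _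
/-- The old part of the all-`1` resolution. [folklore] -/
@[simp] theorem oldOf_stU (σ : G.State) : G.oldOf m tf ε (G.stU m tf ε σ) = σ := G.oldOf_bigonState m tf ε σ _ _
/-- The old part of the oriented resolution. [folklore] -/
@[simp] theorem oldOf_stD (σ : G.State) : G.oldOf m tf ε (G.stD m tf ε σ) = σ := G.oldOf_bigonState m tf ε σ _ _

/-- `f` is `1`-smoothed in the all-`1` resolution. [folklore] -/
theorem stU_fC (σ : G.State) : G.stU m tf ε σ (G.fC m tf ε) = true := by
  unfold stU fC; split_ifs <;> simp

/-- `g` is `1`-smoothed in the all-`1` resolution. [folklore] -/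
theorem stU_gC (σ : G.State) : G.stU m tf ε σ (G.gC m tf ε) = true := by
  unfold stU gC; split_ifs <;> simp

/-- `f` is `0`-smoothed in the oriented resolution. [folklore] -/
theorem stD_fC (σ : G.State) : G.stD m tf ε σ (G.fC m tf ε) = false := by
  unfold stD fC oBitX oBitY; split_ifs with h <;> simp [h]

/-- `g` is `1`-smoothed in the oriented resolution. [folklore] -/
theorem stD_gC (σ : G.State) : G.stD m tf ε σ (G.gC m tf ε) = true := by
  unfold stD gC oBitX oBitY; split_ifs with h <;> simp [h]

/-- For `ε = 1` the positive chord `f = x` is flipped in `stO`. [folklore] -/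
@[simp] theorem oBitX_one : oBitX 1 = true := by decide
/-- For `ε = -1`, `x` is not flipped in `stO`. [folklore] -/
@[simp] theorem oBitX_neg_one : oBitX (-1) = false := by decide
/-- For `ε = 1`, `y` is not flipped in `stO`. [folklore] -/
@[simp] theorem oBitY_one : oBitY 1 = false := by decide
/-- For `ε = -1` the positive chord `f = y` is flipped in `stO`. [folklore] -/
@[simp] theorem oBitY_neg_one : oBitY (-1) = true := by decide
/-- For `ε = 1`, `f = x`. [folklore] -/
@[simp] theorem fC_one : G.fC m tf 1 = G.bX m tf 1 := if_pos rfl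
/-- For `ε = -1`, `f = y`. [folklore] -/
@[simp] theorem fC_neg_one : G.fC m tf (-1) = G.bY m tf (-1) := if_neg (by decide)
/-- For `ε = 1`, `g = y`. [folklore] -/
@[simp] theorem gC_one : G.gC m tf 1 = G.bY m tf 1 := if_pos rfl
/-- For `ε = -1`, `g = x`. [folklore] -/
@[simp] theorem gC_neg_one : G.gC m tf (-1) = G.bX m tf (-1) := if_neg (by decide)

/-- **A state of the bigon is determined by its old part and its smoothings of `f` and `g`**:
the four sectors. [folklore] -/
theorem state_eq_of_fC_gC (τ : (G.bigon m tf ε).State) :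
    (τ (G.fC m tf ε) = false → τ (G.gC m tf ε) = false → τ = G.stA m tf ε (G.oldOf m tf ε τ)) ∧
    (τ (G.fC m tf ε) = true → τ (G.gC m tf ε) = false → τ = G.stO m tf ε (G.oldOf m tf ε τ)) ∧
    (τ (G.fC m tf ε) = true → τ (G.gC m tf ε) = true → τ = G.stU m tf ε (G.oldOf m tf ε τ)) ∧
    (τ (G.fC m tf ε) = false → τ (G.gC m tf ε) = true → τ = G.stD m tf ε (G.oldOf m tf ε τ)) := by
  have key : ∀ a b : Bool, τ (G.bX m tf ε) = a → τ (G.bY m tf ε) = b →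
      τ = G.bigonState m tf ε (G.oldOf m tf ε τ) a b := by
    rintro a b rfl rfl
    exact G.eq_bigonState m tf ε τ
  unfold stA stO stU stD
  rcases Int.units_eq_one_or ε with rfl | rfl
  · simp only [fC_one, gC_one, oBitX_one, oBitY_one]
    exact ⟨fun h1 h2 ↦ key _ _ h1 h2, fun h1 h2 ↦ key _ _ h1 h2, fun h1 h2 ↦ key _ _ h1 h2,
      fun h1 h2 ↦ key _ _ h1 h2⟩
  · simp only [fC_neg_one, gC_neg_one, oBitX_neg_one, oBitY_neg_one]
    exact ⟨fun h1 h2 ↦ key _ _ h2 h1, fun h1 h2 ↦ key _ _ h2 h1, fun h1 h2 ↦ key _ _ h2 h1,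
      fun h1 h2 ↦ key _ _ h2 h1⟩

/-- Across an edge of the cube no `1`-smoothing becomes a `0`-smoothing: an incidence number from
a state where the chord `j` is `1`-smoothed to one where it is `0`-smoothed vanishes (any Gauss
diagram). [folklore] -/
theorem incidence_eq_zero_of_state_true_false {H : GaussDiagram} {R : Type} [CommRing R] (hR tR : R)
    {t t' : H.EnhancedState} (j : Fin H.n) (h : t.state j = true) (h' : t'.state j = false) :
    H.incidence R hR tR t t' = 0 := by
  by_contra hne
  obtain ⟨i, hi, hs⟩ := exists_of_incidence_ne_zero hne
  have := congrFun hs j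
  by_cases hij : j = i
  · subst hij
    rw [h] at hi
    exact Bool.noConfusion hi
  · rw [Function.update_of_ne hij, h, h'] at this
    exact Bool.noConfusion this

/-! ## The strands of `f` and `g` on and off the small circle -/

/-- The first local strand of `f`. [folklore] -/
def aF : (G.bigon m tf ε).Arc := (G.bigon m tf ε).arcIn ((G.bigon m tf ε).overPos (G.fC m tf ε))

/-- The second local strand of `f`. [folklore] -/
def bF : (G.bigon m tf ε).Arc := (G.bigon m tf ε).arcOut ((G.bigon m tf ε).overPos (G.fC m tf ε))

/-- The first local strand of `g`. [folklore] -/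
def aG : (G.bigon m tf ε).Arc := (G.bigon m tf ε).arcIn ((G.bigon m tf ε).overPos (G.gC m tf ε))

/-- The second local strand of `g`. [folklore] -/
def bG : (G.bigon m tf ε).Arc := (G.bigon m tf ε).arcOut ((G.bigon m tf ε).overPos (G.gC m tf ε))

/-- **The strand of `f` off the small circle** (the one of the two local strands of `f` which is
not a side of the bigon). [folklore] -/
def cF : (G.bigon m tf ε).Arc := if G.InO m tf ε (G.aF m tf ε) then G.bF m tf ε else G.aF m tf ε

/-- **The strand of `g` off the small circle.** [folklore] -/
def cG : (G.bigon m tf ε).Arc := if G.InO m tf ε (G.aG m tf ε) then G.bG m tf ε else G.aG m tf ε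

/-- Exactly one local strand of `f` is a side of the bigon. [folklore] -/
theorem inO_aF_bF :
    (¬ G.InO m tf ε (G.aF m tf ε) ∧ G.InO m tf ε (G.bF m tf ε)) ∨
      (G.InO m tf ε (G.aF m tf ε) ∧ ¬ G.InO m tf ε (G.bF m tf ε)) :=
  G.inO_strands_fC m tf ε

/-- Exactly one local strand of `g` is a side of the bigon. [folklore] -/
theorem inO_aG_bG :
    (¬ G.InO m tf ε (G.aG m tf ε) ∧ G.InO m tf ε (G.bG m tf ε)) ∨
      (G.InO m tf ε (G.aG m tf ε) ∧ ¬ G.InO m tf ε (G.bG m tf ε)) :=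
  G.inO_strands_gC m tf ε

/-- The strand of `f` off the small circle is off the small circle. [folklore] -/
theorem not_inO_cF : ¬ G.InO m tf ε (G.cF m tf ε) := by
  unfold cF
  rcases G.inO_aF_bF m tf ε with ⟨ha, hb⟩ | ⟨ha, hb⟩
  · rw [if_neg ha]; exact ha
  · rw [if_pos ha]; exact hb

/-- The strand of `g` off the small circle is off the small circle. [folklore] -/
theorem not_inO_cG : ¬ G.InO m tf ε (G.cG m tf ε) := by
  unfold cG
  rcases G.inO_aG_bG m tf ε with ⟨ha, hb⟩ | ⟨ha, hb⟩
  · rw [if_neg ha]; exact ha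
  · rw [if_pos ha]; exact hb

variable (σ : G.State)

/-- In the resolution with the small circle, two sides of the bigon lie on one circle, and an
arc on the circle of a side is a side. [folklore] -/
theorem circleOf_stO_eq_of_inO {u v : (G.bigon m tf ε).Arc} (hu : G.InO m tf ε u) :
    (G.bigon m tf ε).circleOf (G.stO m tf ε σ) v = (G.bigon m tf ε).circleOf (G.stO m tf ε σ) u ↔
      G.InO m tf ε v := by
  rw [(G.circleOf_stO_eq_iff m tf ε σ u).2 hu, circleOf_stO_eq_iff]

/-- In the all-`0` resolution the two local strands of `f` lie on one circle (the circle which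
splits). [folklore] -/
theorem circleOf_stA_aF_eq_bF :
    (G.bigon m tf ε).circleOf (G.stA m tf ε σ) (G.aF m tf ε) =
      (G.bigon m tf ε).circleOf (G.stA m tf ε σ) (G.bF m tf ε) :=
  circleOf_eq_iff.2 (G.isSplitAt_stA m tf ε σ).reachable

/-- Circles of the resolution with the small circle refine those of the all-`0` resolution (the
flip of `f` is a split). [folklore] -/
theorem circleOf_stA_eq_of_stO_eq {u v : (G.bigon m tf ε).Arc}
    (h : (G.bigon m tf ε).circleOf (G.stO m tf ε σ) u = (G.bigon m tf ε).circleOf (G.stO m tf ε σ) v) :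
    (G.bigon m tf ε).circleOf (G.stA m tf ε σ) u = (G.bigon m tf ε).circleOf (G.stA m tf ε σ) v := by
  rw [circleOf_eq_iff] at h ⊢
  rw [← update_stA_fC] at h
  exact (G.isSplitAt_stA m tf ε σ).reachable_of_reachable_update h

/-- In the all-`0` resolution, a side of the bigon lies on the circle of the strands of `f`.
[folklore] -/
theorem circleOf_stA_eq_aF_of_inO {u : (G.bigon m tf ε).Arc} (hu : G.InO m tf ε u) :
    (G.bigon m tf ε).circleOf (G.stA m tf ε σ) u = (G.bigon m tf ε).circleOf (G.stA m tf ε σ) (G.aF m tf ε) := by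
  rcases G.inO_aF_bF m tf ε with ⟨-, hb⟩ | ⟨ha, -⟩
  · rw [circleOf_stA_aF_eq_bF]
    exact G.circleOf_stA_eq_of_stO_eq m tf ε σ ((G.circleOf_stO_eq_of_inO m tf ε σ hb).2 hu)
  · exact G.circleOf_stA_eq_of_stO_eq m tf ε σ ((G.circleOf_stO_eq_of_inO m tf ε σ ha).2 hu)

/-- In the all-`0` resolution, the strand of `f` off the small circle lies on the circle of the
strands of `f`. [folklore] -/
theorem circleOf_stA_cF :
    (G.bigon m tf ε).circleOf (G.stA m tf ε σ) (G.cF m tf ε) =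
      (G.bigon m tf ε).circleOf (G.stA m tf ε σ) (G.aF m tf ε) := by
  unfold cF; split_ifs
  · exact (G.circleOf_stA_aF_eq_bF m tf ε σ).symm
  · rfl

/-- Circles of the resolution with the small circle are contained in circles of the all-`1`
resolution (the flip of `g` is a merge). [folklore] -/
theorem circleOf_stU_eq_of_stO_eq {u v : (G.bigon m tf ε).Arc}
    (h : (G.bigon m tf ε).circleOf (G.stO m tf ε σ) u = (G.bigon m tf ε).circleOf (G.stO m tf ε σ) v) :
    (G.bigon m tf ε).circleOf (G.stU m tf ε σ) u = (G.bigon m tf ε).circleOf (G.stU m tf ε σ) v := by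
  rw [circleOf_eq_iff] at h ⊢
  rw [← update_stO_gC]
  exact (G.isMergeAt_stO m tf ε σ).reachable_update_of_reachable h

/-- In the all-`1` resolution the two local strands of `g` lie on one circle (the merged one).
[folklore] -/
theorem circleOf_stU_aG_eq_bG :
    (G.bigon m tf ε).circleOf (G.stU m tf ε σ) (G.aG m tf ε) =
      (G.bigon m tf ε).circleOf (G.stU m tf ε σ) (G.bG m tf ε) := by
  rw [circleOf_eq_iff, ← update_stO_gC]
  exact (G.isMergeAt_stO m tf ε σ).reachable_update

/-- In the all-`1` resolution, a side of the bigon lies on the merged circle. [folklore] -/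
theorem circleOf_stU_eq_aG_of_inO {u : (G.bigon m tf ε).Arc} (hu : G.InO m tf ε u) :
    (G.bigon m tf ε).circleOf (G.stU m tf ε σ) u = (G.bigon m tf ε).circleOf (G.stU m tf ε σ) (G.aG m tf ε) := by
  rcases G.inO_aG_bG m tf ε with ⟨-, hb⟩ | ⟨ha, -⟩
  · rw [circleOf_stU_aG_eq_bG]
    exact G.circleOf_stU_eq_of_stO_eq m tf ε σ ((G.circleOf_stO_eq_of_inO m tf ε σ hb).2 hu)
  · exact G.circleOf_stU_eq_of_stO_eq m tf ε σ ((G.circleOf_stO_eq_of_inO m tf ε σ ha).2 hu)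

/-- In the all-`1` resolution, the strand of `g` off the small circle lies on the merged circle.
[folklore] -/
theorem circleOf_stU_cG :
    (G.bigon m tf ε).circleOf (G.stU m tf ε σ) (G.cG m tf ε) =
      (G.bigon m tf ε).circleOf (G.stU m tf ε σ) (G.aG m tf ε) := by
  unfold cG; split_ifs
  · exact (G.circleOf_stU_aG_eq_bG m tf ε σ).symm
  · rfl

/-- In the resolution with the small circle, an arc on the circle of the strand of `g` off the
small circle is off the small circle. [folklore] -/
theorem not_inO_of_circleOf_stO_eq_cG {u : (G.bigon m tf ε).Arc}
    (h : (G.bigon m tf ε).circleOf (G.stO m tf ε σ) u = (G.bigon m tf ε).circleOf (G.stO m tf ε σ) (G.cG m tf ε)) :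
    ¬ G.InO m tf ε u := fun hu ↦
  G.not_inO_cG m tf ε ((G.circleOf_stO_eq_of_inO m tf ε σ hu).1 h.symm)

/-! ## The `A`-sector and the embeddings of the five sectors -/

/-- **The `A`-sector**: the enhanced states of the bigon over the all-`0` resolutions of the two
new chords. This finite type indexes each of the four sectors `A`, `P`, `Q`, `U` of the
cancellation. Khovanov (2000), §5.3. [cite: Khovanov2000, §5.3] -/
def XA : Type :=
  {t : (G.bigon m tf ε).EnhancedState // t.state (G.fC m tf ε) = false ∧ t.state (G.gC m tf ε) = false}

/-- The `A`-sector is a finite type. [folklore] -/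
instance instFintypeXA : Fintype (G.XA m tf ε) := by unfold XA; infer_instance
/-- The `A`-sector has decidable equality. [folklore] -/
instance instDecidableEqXA : DecidableEq (G.XA m tf ε) := by unfold XA; infer_instance

variable {G m tf ε} {σ}

/-- The state of an element of the `A`-sector. [folklore] -/
theorem XA.state_eq (x : G.XA m tf ε) : x.1.state = G.stA m tf ε (G.oldOf m tf ε x.1.state) :=
  (G.state_eq_of_fC_gC m tf ε x.1.state).1 x.2.1 x.2.2

/-- Two sides of the bigon carry the same label in an enhanced state over the resolution with the
small circle. [folklore] -/
theorem label_eq_of_inO {t : (G.bigon m tf ε).EnhancedState} {σ : G.State} (ht : t.state = G.stO m tf ε σ)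
    {u v : (G.bigon m tf ε).Arc} (hu : G.InO m tf ε u) (hv : G.InO m tf ε v) : t.label u = t.label v :=
  t.label_eq_of_circleOf_eq (by rw [ht]; exact ((G.circleOf_stO_eq_of_inO m tf ε σ hv).2 hu))

/-- **The sectors `P` (`o = X`) and `Q` (`o = 1`)**: push an element of the `A`-sector across the
split at `f`, labelling the small circle by `o`. Khovanov (2000), §5.3. [cite: Khovanov2000, §5.3] -/
def embO (x : G.XA m tf ε) (o : Bool) : (G.bigon m tf ε).EnhancedState :=
  (G.isSplitAt_stA m tf ε (G.oldOf m tf ε x.1.state)).push (x.1.lab x.state_eq)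
    (if G.InO m tf ε (G.aF m tf ε) then o else x.1.label (G.aF m tf ε))
    (if G.InO m tf ε (G.aF m tf ε) then x.1.label (G.aF m tf ε) else o)

/-- The state of `embO x o`. [folklore] -/
@[simp] theorem embO_state (x : G.XA m tf ε) (o : Bool) :
    (embO x o).state = G.stO m tf ε (G.oldOf m tf ε x.1.state) := by
  unfold embO
  rw [IsSplitAt.push_state, update_stA_fC]

/-- **`embO x o` labels the small circle by `o`.** [folklore] -/
theorem embO_label_of_inO (x : G.XA m tf ε) (o : Bool) {u : (G.bigon m tf ε).Arc} (hu : G.InO m tf ε u) :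
    (embO x o).label u = o := by
  unfold embO
  rw [IsSplitAt.push_label, update_stA_fC]
  rcases G.inO_aF_bF m tf ε with ⟨ha, hb⟩ | ⟨ha, hb⟩
  · rw [if_neg ha, if_neg ha, if_neg, if_pos]
    · exact (G.circleOf_stO_eq_of_inO m tf ε _ hb).2 hu
    · exact fun h ↦ ha ((G.circleOf_stO_eq_of_inO m tf ε _ hu).1 h.symm)
  · rw [if_pos ha, if_pos]
    exact (G.circleOf_stO_eq_of_inO m tf ε _ ha).2 hu

/-- **`embO x o` has the labels of `x` off the small circle.** [folklore] -/
theorem embO_label_of_not_inO (x : G.XA m tf ε) (o : Bool) {u : (G.bigon m tf ε).Arc}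
    (hu : ¬ G.InO m tf ε u) : (embO x o).label u = x.1.label u := by
  unfold embO
  rw [IsSplitAt.push_label, update_stA_fC]
  simp only [EnhancedState.lab_val]
  set σ := G.oldOf m tf ε x.1.state
  have hx : x.1.state = G.stA m tf ε σ := x.state_eq
  -- an arc on the `stO`-circle of a strand of `f` lies on the split circle of `stA`
  have lab : ∀ w : (G.bigon m tf ε).Arc, (G.bigon m tf ε).circleOf (G.stO m tf ε σ) u =
      (G.bigon m tf ε).circleOf (G.stO m tf ε σ) w → (w = G.aF m tf ε ∨ w = G.bF m tf ε) →
      x.1.label (G.aF m tf ε) = x.1.label u := by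
    intro w hw hw'
    apply x.1.label_eq_of_circleOf_eq
    rw [hx]
    have h1 := G.circleOf_stA_eq_of_stO_eq m tf ε σ hw
    rcases hw' with rfl | rfl
    · exact h1.symm
    · rw [h1, circleOf_stA_aF_eq_bF]
  rcases G.inO_aF_bF m tf ε with ⟨ha, hb⟩ | ⟨ha, hb⟩
  · rw [if_neg ha, if_neg ha]
    split_ifs with h1 h2
    · exact lab _ h1 (Or.inl rfl)
    · exact (hu ((G.circleOf_stO_eq_of_inO m tf ε σ hb).1 h2)).elim
    · rfl
  · rw [if_pos ha, if_pos ha]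
    split_ifs with h1 h2
    · exact (hu ((G.circleOf_stO_eq_of_inO m tf ε σ ha).1 h1)).elim
    · exact lab _ h2 (Or.inr rfl)
    · rfl

/-- The label of `embO x o` at `sideM` is `o`. [folklore] -/
@[simp] theorem embO_label_sideM (x : G.XA m tf ε) (o : Bool) : (embO x o).label (G.sideM m tf ε) = o :=
  embO_label_of_inO x o (G.inO_sideM m tf ε)

/-- `embO x o` determines `x`. [folklore] -/
theorem embO_injective (o : Bool) : Injective (fun x : G.XA m tf ε ↦ embO x o) := by
  intro x x' h
  dsimp only at h
  have hσ : G.oldOf m tf ε x.1.state = G.oldOf m tf ε x'.1.state := by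
    have := congrArg EnhancedState.state h
    rw [embO_state, embO_state] at this
    exact (G.bigonState_inj m tf ε this).1
  apply Subtype.ext
  refine EnhancedState.ext' (by rw [x.state_eq, x'.state_eq, hσ]) (funext fun u ↦ ?_)
  by_cases hu : G.InO m tf ε u
  · -- on the small circle: both labels are the label of the strand off it
    have e1 : x.1.label u = x.1.label (G.cF m tf ε) := x.1.label_eq_of_circleOf_eq (by
      rw [x.state_eq, circleOf_stA_cF]; exact G.circleOf_stA_eq_aF_of_inO m tf ε _ hu)
    have e2 : x'.1.label u = x'.1.label (G.cF m tf ε) := x'.1.label_eq_of_circleOf_eq (by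
      rw [x'.state_eq, circleOf_stA_cF]; exact G.circleOf_stA_eq_aF_of_inO m tf ε _ hu)
    rw [e1, e2, ← embO_label_of_not_inO x o (G.not_inO_cF m tf ε),
      ← embO_label_of_not_inO x' o (G.not_inO_cF m tf ε), h]
  · rw [← embO_label_of_not_inO x o hu, ← embO_label_of_not_inO x' o hu, h]

/-- **The sector `U`**: push `embO x 1` across the merge at `g`, the merged circle taking the
label of the strand of `g` off the small circle. Khovanov (2000), §5.3. [cite: Khovanov2000, §5.3] -/
def embU (x : G.XA m tf ε) : (G.bigon m tf ε).EnhancedState :=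
  (G.isMergeAt_stO m tf ε (G.oldOf m tf ε x.1.state)).push ((embO x false).lab (embO_state x false))
    (x.1.label (G.cG m tf ε))

/-- The state of `embU x`. [folklore] -/
@[simp] theorem embU_state (x : G.XA m tf ε) : (embU x).state = G.stU m tf ε (G.oldOf m tf ε x.1.state) := by
  unfold embU
  rw [IsMergeAt.push_state, update_stO_gC]

/-- The labels of `embU x`: the label of `x` at the strand of `g` off the small circle on the
merged circle, the labels of `embO x 1` elsewhere. [folklore] -/
theorem embU_label (x : G.XA m tf ε) (u : (G.bigon m tf ε).Arc) :
    (embU x).label u =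
      if (G.bigon m tf ε).circleOf (G.stU m tf ε (G.oldOf m tf ε x.1.state)) u =
          (G.bigon m tf ε).circleOf (G.stU m tf ε (G.oldOf m tf ε x.1.state)) (G.aG m tf ε)
      then x.1.label (G.cG m tf ε) else (embO x false).label u := by
  unfold embU
  rw [IsMergeAt.push_label, update_stO_gC]
  rfl

/-- **Off the merged circle `embU x` has the labels of `x`**, and so it has on the merged circle
at arcs off the small circle. [folklore] -/
theorem embU_label_of_not_inO (x : G.XA m tf ε) {u : (G.bigon m tf ε).Arc} (hu : ¬ G.InO m tf ε u) :
    (embU x).label u = x.1.label u := by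
  rw [embU_label]
  split_ifs with h
  · -- `u` on the merged circle, off `O`: `u` and `cG` lie on one circle of `stO`, hence of `stA`
    set σ := G.oldOf m tf ε x.1.state
    apply x.1.label_eq_of_circleOf_eq
    rw [x.state_eq]
    apply G.circleOf_stA_eq_of_stO_eq m tf ε σ
    rw [circleOf_eq_iff] at h ⊢
    rw [← update_stO_gC] at h
    have key := (G.isMergeAt_stO m tf ε σ).reachable_update_iff u (G.aG m tf ε)
    rw [key] at h
    -- `MergedReach`: `u ~ aG`, or `u ~ aG ∧ bG ~ aG`, or `u ~ bG ∧ aG ~ aG`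
    have hcG : ∀ w, (w = G.aG m tf ε ∨ w = G.bG m tf ε) →
        ((G.bigon m tf ε).stateGraph (G.stO m tf ε σ)).Reachable u w →
        ((G.bigon m tf ε).stateGraph (G.stO m tf ε σ)).Reachable (G.cG m tf ε) w := by
      intro w hw huw
      unfold cG
      rcases G.inO_aG_bG m tf ε with ⟨ha, hb⟩ | ⟨ha, hb⟩
      · rw [if_neg ha]
        rcases hw with rfl | rfl
        · rfl
        · exact (hu ((G.circleOf_stO_eq_of_inO m tf ε σ hb).1 (circleOf_eq_iff.2 huw))).elim
      · rw [if_pos ha]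
        rcases hw with rfl | rfl
        · exact (hu ((G.circleOf_stO_eq_of_inO m tf ε σ ha).1 (circleOf_eq_iff.2 huw))).elim
        · rfl
    rcases h with h | ⟨h, -⟩ | ⟨h, -⟩
    · exact (h.trans (hcG _ (Or.inl rfl) h).symm).symm
    · exact (h.trans (hcG _ (Or.inl rfl) h).symm).symm
    · exact (h.trans (hcG _ (Or.inr rfl) h).symm).symm
  · exact embO_label_of_not_inO x false hu

/-- **On the merged circle `embU x` has the label of `x` at the strand of `g` off the small
circle**; in particular on the small circle. [folklore] -/
theorem embU_label_of_inO (x : G.XA m tf ε) {u : (G.bigon m tf ε).Arc} (hu : G.InO m tf ε u) :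
    (embU x).label u = x.1.label (G.cG m tf ε) := by
  rw [embU_label, if_pos (G.circleOf_stU_eq_aG_of_inO m tf ε _ hu)]

/-- The label of `embU x` at the first strand of `g`. [folklore] -/
theorem embU_label_aG (x : G.XA m tf ε) : (embU x).label (G.aG m tf ε) = x.1.label (G.cG m tf ε) := by
  rw [embU_label, if_pos rfl]

/-- `embU` is injective. [folklore] -/
theorem embU_injective : Injective (embU (G := G) (m := m) (tf := tf) (ε := ε)) := by
  intro x x' h
  have hσ : G.oldOf m tf ε x.1.state = G.oldOf m tf ε x'.1.state := by
    have := congrArg EnhancedState.state h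
    rw [embU_state, embU_state] at this
    exact (G.bigonState_inj m tf ε this).1
  apply Subtype.ext
  refine EnhancedState.ext' (by rw [x.state_eq, x'.state_eq, hσ]) (funext fun u ↦ ?_)
  by_cases hu : G.InO m tf ε u
  · have e1 : x.1.label u = x.1.label (G.cF m tf ε) := x.1.label_eq_of_circleOf_eq (by
      rw [x.state_eq, circleOf_stA_cF]; exact G.circleOf_stA_eq_aF_of_inO m tf ε _ hu)
    have e2 : x'.1.label u = x'.1.label (G.cF m tf ε) := x'.1.label_eq_of_circleOf_eq (by
      rw [x'.state_eq, circleOf_stA_cF]; exact G.circleOf_stA_eq_aF_of_inO m tf ε _ hu)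
    rw [e1, e2, ← embU_label_of_not_inO x (G.not_inO_cF m tf ε),
      ← embU_label_of_not_inO x' (G.not_inO_cF m tf ε), h]
  · rw [← embU_label_of_not_inO x hu, ← embU_label_of_not_inO x' hu, h]

/-! ## Pulling back to the `A`-sector -/

/-- **Pull an enhanced state over a resolution with the small circle back to the `A`-sector**
(the split circle takes the label of the strand of `f` off the small circle). [folklore] -/
def pullA (t : (G.bigon m tf ε).EnhancedState)
    (ht : t.state (G.fC m tf ε) = true ∧ t.state (G.gC m tf ε) = false) : G.XA m tf ε :=
  ⟨(G.isSplitAt_stA m tf ε (G.oldOf m tf ε t.state)).pull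
      (t.lab (((G.state_eq_of_fC_gC m tf ε t.state).2.1 ht.1 ht.2).trans
        (G.update_stA_fC m tf ε _).symm))
      (t.label (G.cF m tf ε)),
    by simp only [IsSplitAt.pull_state]; exact ⟨G.stA_fC m tf ε _, G.stA_gC m tf ε _⟩⟩

/-- The state of `pullA t`. [folklore] -/
@[simp] theorem pullA_state (t : (G.bigon m tf ε).EnhancedState)
    (ht : t.state (G.fC m tf ε) = true ∧ t.state (G.gC m tf ε) = false) :
    (pullA t ht).1.state = G.stA m tf ε (G.oldOf m tf ε t.state) := rfl

/-- **`pullA t` has the labels of `t` off the small circle.** [folklore] -/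
theorem pullA_label_of_not_inO (t : (G.bigon m tf ε).EnhancedState)
    (ht : t.state (G.fC m tf ε) = true ∧ t.state (G.gC m tf ε) = false) {u : (G.bigon m tf ε).Arc}
    (hu : ¬ G.InO m tf ε u) : (pullA t ht).1.label u = t.label u := by
  have hst : t.state = G.stO m tf ε (G.oldOf m tf ε t.state) :=
    (G.state_eq_of_fC_gC m tf ε t.state).2.1 ht.1 ht.2
  show ((G.isSplitAt_stA m tf ε (G.oldOf m tf ε t.state)).pull _ _).label u = _
  rw [IsSplitAt.pull_label]
  split_ifs with h
  · -- `u` on the split circle, off `O`: `u` and `cF` lie on one circle of `stO`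
    apply t.label_eq_of_circleOf_eq
    rw [hst]
    set σ := G.oldOf m tf ε t.state
    rw [circleOf_eq_iff, ← update_stA_fC]
    rw [circleOf_eq_iff] at h
    have key := ((G.isSplitAt_stA m tf ε σ).reachable_iff u (G.aF m tf ε)).1 h
    rw [update_stA_fC] at key ⊢
    have hcF : ∀ w, (w = G.aF m tf ε ∨ w = G.bF m tf ε) →
        ((G.bigon m tf ε).stateGraph (G.stO m tf ε σ)).Reachable u w →
        ((G.bigon m tf ε).stateGraph (G.stO m tf ε σ)).Reachable (G.cF m tf ε) w := by
      intro w hw huw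
      unfold cF
      rcases G.inO_aF_bF m tf ε with ⟨ha, hb⟩ | ⟨ha, hb⟩
      · rw [if_neg ha]
        rcases hw with rfl | rfl
        · rfl
        · exact (hu ((G.circleOf_stO_eq_of_inO m tf ε σ hb).1 (circleOf_eq_iff.2 huw))).elim
      · rw [if_pos ha]
        rcases hw with rfl | rfl
        · exact (hu ((G.circleOf_stO_eq_of_inO m tf ε σ ha).1 (circleOf_eq_iff.2 huw))).elim
        · rfl
    rcases key with h | ⟨h, -⟩ | ⟨h, -⟩
    · exact (h.trans (hcF _ (Or.inl rfl) h).symm).symm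
    · exact (h.trans (hcF _ (Or.inl rfl) h).symm).symm
    · exact (h.trans (hcF _ (Or.inr rfl) h).symm).symm
  · rfl

/-- **`pullA t` has the label of `t` at the strand of `f` off the small circle, on the small
circle.** [folklore] -/
theorem pullA_label_of_inO (t : (G.bigon m tf ε).EnhancedState)
    (ht : t.state (G.fC m tf ε) = true ∧ t.state (G.gC m tf ε) = false) {u : (G.bigon m tf ε).Arc}
    (hu : G.InO m tf ε u) : (pullA t ht).1.label u = t.label (G.cF m tf ε) := by
  show ((G.isSplitAt_stA m tf ε (G.oldOf m tf ε t.state)).pull _ _).label u = _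
  rw [IsSplitAt.pull_label]
  exact if_pos (G.circleOf_stA_eq_aF_of_inO m tf ε _ hu)

/-- **Push after pull**: an enhanced state over a resolution with the small circle is `embO` of
its pull-back, with its own label on the small circle. [folklore] -/
theorem embO_pullA (t : (G.bigon m tf ε).EnhancedState)
    (ht : t.state (G.fC m tf ε) = true ∧ t.state (G.gC m tf ε) = false) :
    embO (pullA t ht) (t.label (G.sideM m tf ε)) = t := by
  have hst : t.state = G.stO m tf ε (G.oldOf m tf ε t.state) :=
    (G.state_eq_of_fC_gC m tf ε t.state).2.1 ht.1 ht.2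
  refine EnhancedState.ext' (by rw [embO_state, pullA_state, oldOf_stA, ← hst]) (funext fun u ↦ ?_)
  by_cases hu : G.InO m tf ε u
  · rw [embO_label_of_inO _ _ hu]
    exact label_eq_of_inO hst (G.inO_sideM m tf ε) hu
  · rw [embO_label_of_not_inO _ _ hu, pullA_label_of_not_inO t ht hu]

/-- **Pull after push**: `pullA (embO x o) = x`. [folklore] -/
theorem pullA_embO (x : G.XA m tf ε) (o : Bool)
    (h : (embO x o).state (G.fC m tf ε) = true ∧ (embO x o).state (G.gC m tf ε) = false) :
    pullA (embO x o) h = x := by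
  apply Subtype.ext
  refine EnhancedState.ext' ?_ (funext fun u ↦ ?_)
  · rw [pullA_state, embO_state, oldOf_stO, ← x.state_eq]
  · by_cases hu : G.InO m tf ε u
    · rw [pullA_label_of_inO _ h hu, embO_label_of_not_inO x o (G.not_inO_cF m tf ε)]
      apply x.1.label_eq_of_circleOf_eq
      rw [x.state_eq, circleOf_stA_cF]
      exact (G.circleOf_stA_eq_aF_of_inO m tf ε _ hu).symm
    · rw [pullA_label_of_not_inO _ h hu, embO_label_of_not_inO x o hu]

/-- The sector conditions of a pushed state. [folklore] -/
theorem embO_fC_gC (x : G.XA m tf ε) (o : Bool) :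
    (embO x o).state (G.fC m tf ε) = true ∧ (embO x o).state (G.gC m tf ε) = false := by
  rw [embO_state]
  exact ⟨G.stO_fC m tf ε _, G.stO_gC m tf ε _⟩

/-- **Pull an enhanced state over an all-`1` resolution back across the merge at `g`**, the small
circle taking the label `1` and the other circle the label of the merged circle. [folklore] -/
def pullU (t : (G.bigon m tf ε).EnhancedState)
    (ht : t.state (G.fC m tf ε) = true ∧ t.state (G.gC m tf ε) = true) : (G.bigon m tf ε).EnhancedState :=
  (G.isMergeAt_stO m tf ε (G.oldOf m tf ε t.state)).pull
    (t.lab (((G.state_eq_of_fC_gC m tf ε t.state).2.2.1 ht.1 ht.2).trans (G.update_stO_gC m tf ε _).symm))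
    (if G.InO m tf ε (G.aG m tf ε) then false else t.label (G.aG m tf ε))
    (if G.InO m tf ε (G.aG m tf ε) then t.label (G.aG m tf ε) else false)

/-- The state of `pullU t`. [folklore] -/
@[simp] theorem pullU_state (t : (G.bigon m tf ε).EnhancedState)
    (ht : t.state (G.fC m tf ε) = true ∧ t.state (G.gC m tf ε) = true) :
    (pullU t ht).state = G.stO m tf ε (G.oldOf m tf ε t.state) := rfl

/-- **`pullU t` labels the small circle by `1`.** [folklore] -/
theorem pullU_label_of_inO (t : (G.bigon m tf ε).EnhancedState)
    (ht : t.state (G.fC m tf ε) = true ∧ t.state (G.gC m tf ε) = true) {u : (G.bigon m tf ε).Arc}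
    (hu : G.InO m tf ε u) : (pullU t ht).label u = false := by
  unfold pullU
  rw [IsMergeAt.pull_label]
  set σ := G.oldOf m tf ε t.state
  rcases G.inO_aG_bG m tf ε with ⟨ha, hb⟩ | ⟨ha, hb⟩
  · rw [if_neg ha, if_neg ha, if_neg, if_pos]
    · exact (G.circleOf_stO_eq_of_inO m tf ε _ hb).2 hu
    · exact fun h ↦ ha ((G.circleOf_stO_eq_of_inO m tf ε _ hu).1 h.symm)
  · rw [if_pos ha, if_pos]
    exact (G.circleOf_stO_eq_of_inO m tf ε _ ha).2 hu

/-- **`pullU t` has the labels of `t` off the small circle.** [folklore] -/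
theorem pullU_label_of_not_inO (t : (G.bigon m tf ε).EnhancedState)
    (ht : t.state (G.fC m tf ε) = true ∧ t.state (G.gC m tf ε) = true) {u : (G.bigon m tf ε).Arc}
    (hu : ¬ G.InO m tf ε u) : (pullU t ht).label u = t.label u := by
  have hst : t.state = G.stU m tf ε (G.oldOf m tf ε t.state) :=
    (G.state_eq_of_fC_gC m tf ε t.state).2.2.1 ht.1 ht.2
  unfold pullU
  rw [IsMergeAt.pull_label]
  simp only [EnhancedState.lab_val]
  set σ := G.oldOf m tf ε t.state
  -- an arc on the `stO`-circle of a strand of `g` has, in `t`, the label of that strand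
  have lab : ∀ w : (G.bigon m tf ε).Arc, (G.bigon m tf ε).circleOf (G.stO m tf ε σ) u =
      (G.bigon m tf ε).circleOf (G.stO m tf ε σ) w → (w = G.aG m tf ε ∨ w = G.bG m tf ε) →
      t.label (G.aG m tf ε) = t.label u := by
    intro w hw hw'
    apply t.label_eq_of_circleOf_eq
    rw [hst]
    have h1 := G.circleOf_stU_eq_of_stO_eq m tf ε σ hw
    rcases hw' with rfl | rfl
    · exact h1.symm
    · rw [h1, circleOf_stU_aG_eq_bG]
  rcases G.inO_aG_bG m tf ε with ⟨ha, hb⟩ | ⟨ha, hb⟩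
  · rw [if_neg ha, if_neg ha]
    split_ifs with h1 h2
    · exact lab _ h1 (Or.inl rfl)
    · exact (hu ((G.circleOf_stO_eq_of_inO m tf ε σ hb).1 h2)).elim
    · rfl
  · rw [if_pos ha, if_pos ha]
    split_ifs with h1 h2
    · exact (hu ((G.circleOf_stO_eq_of_inO m tf ε σ ha).1 h1)).elim
    · exact lab _ h2 (Or.inr rfl)
    · rfl

/-- The sector conditions of `pullU t`. [folklore] -/
theorem pullU_fC_gC (t : (G.bigon m tf ε).EnhancedState)
    (ht : t.state (G.fC m tf ε) = true ∧ t.state (G.gC m tf ε) = true) :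
    (pullU t ht).state (G.fC m tf ε) = true ∧ (pullU t ht).state (G.gC m tf ε) = false := by
  rw [pullU_state]
  exact ⟨G.stO_fC m tf ε _, G.stO_gC m tf ε _⟩

/-- **An enhanced state over an all-`1` resolution is `embU` of the pull-back of its pull-back.**
[folklore] -/
theorem embU_pullA_pullU (t : (G.bigon m tf ε).EnhancedState)
    (ht : t.state (G.fC m tf ε) = true ∧ t.state (G.gC m tf ε) = true) :
    embU (pullA (pullU t ht) (pullU_fC_gC t ht)) = t := by
  have hst : t.state = G.stU m tf ε (G.oldOf m tf ε t.state) :=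
    (G.state_eq_of_fC_gC m tf ε t.state).2.2.1 ht.1 ht.2
  set x := pullA (pullU t ht) (pullU_fC_gC t ht) with hx
  have hσ : G.oldOf m tf ε x.1.state = G.oldOf m tf ε t.state := by
    rw [hx, pullA_state, pullU_state, oldOf_stO, oldOf_stA]
  refine EnhancedState.ext' (by rw [embU_state, hσ, ← hst]) (funext fun u ↦ ?_)
  have hcG : x.1.label (G.cG m tf ε) = t.label (G.cG m tf ε) := by
    rw [hx, pullA_label_of_not_inO _ _ (G.not_inO_cG m tf ε),
      pullU_label_of_not_inO _ _ (G.not_inO_cG m tf ε)]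
  by_cases hu : G.InO m tf ε u
  · rw [embU_label_of_inO x hu, hcG]
    apply t.label_eq_of_circleOf_eq
    rw [hst, circleOf_stU_cG]
    exact (G.circleOf_stU_eq_aG_of_inO m tf ε _ hu).symm
  · rw [embU_label_of_not_inO x hu, hx, pullA_label_of_not_inO _ _ hu, pullU_label_of_not_inO _ _ hu]

/-! ## The bijection with the five sectors -/

variable (G m tf ε)

/-- **The basis of the complex of the bigon adapted to the cancellation**: the map from
`A ⊕ P ⊕ Q ⊕ U ⊕ C(D)` (the `A`-sector four times and the enhanced states of `G`) to the
enhanced states of the bigon. Khovanov (2000), §5.3; Bar-Natan (2002), §4.3. [cite: Khovanov2000, §5.3] -/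
def embSum : G.XA m tf ε ⊕ (G.XA m tf ε ⊕ (G.XA m tf ε ⊕ (G.XA m tf ε ⊕ G.EnhancedState))) →
    (G.bigon m tf ε).EnhancedState :=
  Sum.elim (fun x ↦ x.1) (Sum.elim (fun x ↦ embO x true) (Sum.elim (fun x ↦ embO x false)
    (Sum.elim embU (bigonD m tf ε))))

/-- `embSum` on the sector `A`. [folklore] -/
@[simp] theorem embSum_inl (x : G.XA m tf ε) : G.embSum m tf ε (.inl x) = x.1 := rfl
/-- `embSum` on the sector `P`. [folklore] -/
@[simp] theorem embSum_inr_inl (x : G.XA m tf ε) : G.embSum m tf ε (.inr (.inl x)) = embO x true := rfl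
/-- `embSum` on the sector `Q`. [folklore] -/
@[simp] theorem embSum_inr_inr_inl (x : G.XA m tf ε) :
    G.embSum m tf ε (.inr (.inr (.inl x))) = embO x false := rfl
/-- `embSum` on the sector `U`. [folklore] -/
@[simp] theorem embSum_inr_inr_inr_inl (x : G.XA m tf ε) :
    G.embSum m tf ε (.inr (.inr (.inr (.inl x)))) = embU x := rfl
/-- `embSum` on the sector `D`. [folklore] -/
@[simp] theorem embSum_inr_inr_inr_inr (s : G.EnhancedState) :
    G.embSum m tf ε (.inr (.inr (.inr (.inr s)))) = bigonD m tf ε s := rfl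

/-- The smoothings of `f`, `g` and the label of `sideM` of an embedded basis vector, by sector.
[folklore] -/
theorem embSum_sig (a : G.XA m tf ε ⊕ (G.XA m tf ε ⊕ (G.XA m tf ε ⊕ (G.XA m tf ε ⊕ G.EnhancedState)))) :
    ((G.embSum m tf ε a).state (G.fC m tf ε), (G.embSum m tf ε a).state (G.gC m tf ε)) =
      Sum.elim (fun _ ↦ (false, false)) (Sum.elim (fun _ ↦ (true, false))
        (Sum.elim (fun _ ↦ (true, false)) (Sum.elim (fun _ ↦ (true, true))
          (fun _ ↦ (false, true))))) a := by
  rcases a with x | x | x | x | s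
  · exact Prod.ext x.2.1 x.2.2
  · simp only [embSum_inr_inl, embO_state, Sum.elim_inr, Sum.elim_inl]
    exact Prod.ext (G.stO_fC m tf ε _) (G.stO_gC m tf ε _)
  · simp only [embSum_inr_inr_inl, embO_state, Sum.elim_inr, Sum.elim_inl]
    exact Prod.ext (G.stO_fC m tf ε _) (G.stO_gC m tf ε _)
  · simp only [embSum_inr_inr_inr_inl, embU_state, Sum.elim_inr, Sum.elim_inl]
    exact Prod.ext (G.stU_fC m tf ε _) (G.stU_gC m tf ε _)
  · simp only [embSum_inr_inr_inr_inr, bigonD_state, Sum.elim_inr]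
    exact Prod.ext (G.stD_fC m tf ε _) (G.stD_gC m tf ε _)

/-- `embSum` is injective. [folklore] -/
theorem embSum_injective : Injective (G.embSum m tf ε) := by
  intro a b h
  have hsig := G.embSum_sig m tf ε a
  rw [h, embSum_sig] at hsig
  rcases a with x | x | x | x | s <;> rcases b with y | y | y | y | s' <;>
    simp only [Sum.elim_inl, Sum.elim_inr, Prod.mk.injEq, Bool.true_eq_false, Bool.false_eq_true,
      and_false, and_true, and_self] at hsig
  · exact congrArg Sum.inl (Subtype.ext h)
  · exact congrArg (fun y ↦ Sum.inr (Sum.inl y)) (embO_injective true h)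
  · have := congrArg (fun t : (G.bigon m tf ε).EnhancedState ↦ t.label (G.sideM m tf ε)) h
    simp at this
  · have := congrArg (fun t : (G.bigon m tf ε).EnhancedState ↦ t.label (G.sideM m tf ε)) h
    simp at this
  · exact congrArg (fun y ↦ Sum.inr (Sum.inr (Sum.inl y))) (embO_injective false h)
  · exact congrArg (fun y ↦ Sum.inr (Sum.inr (Sum.inr (Sum.inl y)))) (embU_injective h)
  · exact congrArg (fun y ↦ Sum.inr (Sum.inr (Sum.inr (Sum.inr y)))) (bigonD_injective m tf ε h)

/-- `embSum` is surjective: **every enhanced state of the bigon lies in one of the five sectors.**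
[folklore] -/
theorem embSum_surjective : Surjective (G.embSum m tf ε) := by
  intro t
  cases hf : t.state (G.fC m tf ε) <;> cases hg : t.state (G.gC m tf ε)
  · exact ⟨.inl ⟨t, hf, hg⟩, rfl⟩
  · obtain ⟨s, -, hs⟩ := eq_bigonD_of_state_eq m tf ε t ((G.state_eq_of_fC_gC m tf ε t.state).2.2.2 hf hg)
    exact ⟨.inr (.inr (.inr (.inr s))), hs⟩
  · have key := embO_pullA t ⟨hf, hg⟩
    cases ho : t.label (G.sideM m tf ε)
    · refine ⟨.inr (.inr (.inl (pullA t ⟨hf, hg⟩))), ?_⟩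
      rw [ho] at key
      exact key
    · refine ⟨.inr (.inl (pullA t ⟨hf, hg⟩)), ?_⟩
      rw [ho] at key
      exact key
  · exact ⟨.inr (.inr (.inr (.inl (pullA (pullU t ⟨hf, hg⟩) (pullU_fC_gC t ⟨hf, hg⟩))))),
      embU_pullA_pullU t ⟨hf, hg⟩⟩

/-- **The bijection of the five sectors with the enhanced states of the bigon.**
Khovanov (2000), §5.3; Bar-Natan (2002), §4.3. [cite: Khovanov2000, §5.3] -/
def bigonESEquiv : G.XA m tf ε ⊕ (G.XA m tf ε ⊕ (G.XA m tf ε ⊕ (G.XA m tf ε ⊕ G.EnhancedState))) ≃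
    (G.bigon m tf ε).EnhancedState :=
  Equiv.ofBijective (G.embSum m tf ε) ⟨G.embSum_injective m tf ε, G.embSum_surjective m tf ε⟩

/-- `bigonESEquiv` is `embSum`. [folklore] -/
@[simp] theorem bigonESEquiv_apply
    (a : G.XA m tf ε ⊕ (G.XA m tf ε ⊕ (G.XA m tf ε ⊕ (G.XA m tf ε ⊕ G.EnhancedState)))) :
    G.bigonESEquiv m tf ε a = G.embSum m tf ε a := rfl

/-! ## The blocks of the differential -/

variable {G m tf ε}

section Ring

variable {R : Type} [CommRing R] (hR tR : R)

/-- Old chords never change the label of the small circle: **an incidence number between two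
states over resolutions with the small circle that label it differently vanishes** (the block
`Q → P`). Khovanov (2000), §5.3 (`d` preserves the decomposition `V ⊗ 1 ⊕ V ⊗ X` of
`C(D ⊔ O)`). [cite: Khovanov2000, §5.3] -/
theorem incidence_eq_zero_of_label_sideM_ne {t t' : (G.bigon m tf ε).EnhancedState} {σ σ' : G.State}
    (ht : t.state = G.stO m tf ε σ) (ht' : t'.state = G.stO m tf ε σ')
    (hl : t.label (G.sideM m tf ε) ≠ t'.label (G.sideM m tf ε)) :
    (G.bigon m tf ε).incidence R hR tR t t' = 0 := by
  by_contra hne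
  obtain ⟨j, hj, hs⟩ := exists_of_incidence_ne_zero hne
  -- the flipped chord is an old one
  obtain ⟨i, rfl⟩ : ∃ i, j = G.oldC m tf ε i := by
    rcases G.eq_oldC_or_bX_or_bY m tf ε j with ⟨i, rfl⟩ | rfl | rfl
    · exact ⟨i, rfl⟩
    · exfalso
      have h1 := congrFun hs (G.bX m tf ε)
      rw [Function.update_self, ht'] at h1
      rw [ht] at hj
      unfold stO at h1 hj
      rw [bigonState_bX] at h1 hj
      rw [hj] at h1
      exact Bool.noConfusion h1
    · exfalso
      have h1 := congrFun hs (G.bY m tf ε)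
      rw [Function.update_self, ht'] at h1
      rw [ht] at hj
      unfold stO at h1 hj
      rw [bigonState_bY] at h1 hj
      rw [hj] at h1
      exact Bool.noConfusion h1
  have hσ' : σ' = Function.update σ i true := by
    rw [ht, ht'] at hs
    unfold stO at hs
    rw [update_bigonState_oldC] at hs
    exact (G.bigonState_inj m tf ε hs).1
  -- in both states the small circle is off the circle of the first strand of `i`
  have hoff : ∀ τ : G.State, (G.bigon m tf ε).circleOf (G.stO m tf ε τ) (G.sideM m tf ε) ≠
      (G.bigon m tf ε).circleOf (G.stO m tf ε τ)
        ((G.bigon m tf ε).arcIn ((G.bigon m tf ε).overPos (G.oldC m tf ε i))) := by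
    intro τ h
    rw [overPos_bigon_oldC] at h
    exact G.not_inO_arcIn_bEmb m tf ε _ ((G.circleOf_stO_eq_iff m tf ε τ _).1 h.symm)
  rw [(G.bigon m tf ε).incidence_of_flip R hR tR hj hs] at hne
  by_cases hm : (G.bigon m tf ε).IsMergeAt t.state (G.oldC m tf ε i)
  · rw [if_pos hm] at hne
    by_cases hc : ∀ c, (G.bigon m tf ε).circleOf t'.state c ≠
        (G.bigon m tf ε).circleOf t'.state
          ((G.bigon m tf ε).arcIn ((G.bigon m tf ε).overPos (G.oldC m tf ε i))) →
        t'.label c = t.label c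
    · exact hl (hc _ (by rw [ht', hσ']; exact hoff _)).symm
    · rw [if_neg hc] at hne
      exact hne rfl
  · rw [if_neg hm] at hne
    by_cases hsp : (G.bigon m tf ε).IsSplitAt t.state (G.oldC m tf ε i)
    · rw [if_pos hsp] at hne
      by_cases hc : ∀ c, (G.bigon m tf ε).circleOf t.state c ≠
          (G.bigon m tf ε).circleOf t.state
            ((G.bigon m tf ε).arcIn ((G.bigon m tf ε).overPos (G.oldC m tf ε i))) →
          t'.label c = t.label c
      · exact hl (hc _ (by rw [ht]; exact hoff _)).symm
      · rw [if_neg hc] at hne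
        exact hne rfl
    · rw [if_neg hsp] at hne
      exact hne rfl

/-- The entries of the comultiplication table on the column `(-) ⊗ X`: the identity. [folklore] -/
theorem splitCoeff_o_true (ℓ ℓ' : Bool) (hO : Bool) :
    (if hO then splitCoeff R hR tR ℓ true ℓ' else splitCoeff R hR tR ℓ ℓ' true) =
      if ℓ' = ℓ then 1 else 0 := by
  cases hO <;> cases ℓ <;> cases ℓ' <;> rfl

/-- **The block `A → P` is the identity up to the Koszul sign.** For `x, x'` in the `A`-sector,
`⟨d x, embO x' X⟩ = [x = x'] · edgeSign`: across the split at `f` the component of `Δ` on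
`(-) ⊗ X` is the identity (`Δ 1 = 1 ⊗ X + …`, `Δ X = X ⊗ X + …`). Khovanov (2000), §5.3, (5);
Bar-Natan (2002), §4.3. [cite: Khovanov2000, §5.3] -/
theorem incidence_embA_embP (x x' : G.XA m tf ε) :
    (G.bigon m tf ε).incidence R hR tR x.1 (embO x' true) =
      if x = x' then (edgeSign (G.stA m tf ε (G.oldOf m tf ε x.1.state)) (G.fC m tf ε) : R) else 0 := by
  by_cases hss : G.oldOf m tf ε x.1.state = G.oldOf m tf ε x'.1.state
  · -- same old state: the entry of the comultiplication table
    have hx : x.1.state = G.stA m tf ε (G.oldOf m tf ε x'.1.state) := by rw [← hss]; exact x.state_eq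
    have key := (G.isSplitAt_stA m tf ε (G.oldOf m tf ε x'.1.state)).incidence_push' hR tR x.1 hx
      (x'.1.lab x'.state_eq)
      (if G.InO m tf ε (G.aF m tf ε) then true else x'.1.label (G.aF m tf ε))
      (if G.InO m tf ε (G.aF m tf ε) then x'.1.label (G.aF m tf ε) else true)
    change (G.bigon m tf ε).incidence R hR tR x.1 (embO x' true) = _ at key
    rw [key]
    simp only [EnhancedState.lab_val]
    change (if ∀ u, (G.bigon m tf ε).circleOf (G.stA m tf ε (G.oldOf m tf ε x'.1.state)) u ≠
        (G.bigon m tf ε).circleOf (G.stA m tf ε (G.oldOf m tf ε x'.1.state)) (G.aF m tf ε) →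
        x'.1.label u = x.1.label u then
      (edgeSign (G.stA m tf ε (G.oldOf m tf ε x'.1.state)) (G.fC m tf ε) : R) *
        splitCoeff R hR tR (x.1.label (G.aF m tf ε))
          (if G.InO m tf ε (G.aF m tf ε) then true else x'.1.label (G.aF m tf ε))
          (if G.InO m tf ε (G.aF m tf ε) then x'.1.label (G.aF m tf ε) else true) else 0) = _
    have tab : splitCoeff R hR tR (x.1.label (G.aF m tf ε))
        (if G.InO m tf ε (G.aF m tf ε) then true else x'.1.label (G.aF m tf ε))
        (if G.InO m tf ε (G.aF m tf ε) then x'.1.label (G.aF m tf ε) else true) =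
        if x'.1.label (G.aF m tf ε) = x.1.label (G.aF m tf ε) then 1 else 0 := by
      rw [← splitCoeff_o_true hR tR (x.1.label (G.aF m tf ε)) (x'.1.label (G.aF m tf ε))
        (decide (G.InO m tf ε (G.aF m tf ε)))]
      by_cases h : G.InO m tf ε (G.aF m tf ε) <;> simp [h]
    rw [tab, hss]
    by_cases hxx : x = x'
    · subst hxx
      rw [if_pos (fun u _ ↦ rfl), if_pos rfl, if_pos rfl, mul_one]
    · rw [if_neg hxx]
      split_ifs with hC hℓ
      · -- labels agree off and on the split circle: `x = x'`
        exfalso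
        apply hxx
        apply Subtype.ext
        refine EnhancedState.ext' (hx.trans x'.state_eq.symm) (funext fun u ↦ ?_)
        by_cases hu : (G.bigon m tf ε).circleOf (G.stA m tf ε (G.oldOf m tf ε x'.1.state)) u =
            (G.bigon m tf ε).circleOf (G.stA m tf ε (G.oldOf m tf ε x'.1.state)) (G.aF m tf ε)
        · have hu1 : (G.bigon m tf ε).circleOf x.1.state u =
              (G.bigon m tf ε).circleOf x.1.state (G.aF m tf ε) := by rw [hx]; exact hu
          have hu2 : (G.bigon m tf ε).circleOf x'.1.state u =
              (G.bigon m tf ε).circleOf x'.1.state (G.aF m tf ε) := by rw [x'.state_eq]; exact hu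
          rw [x.1.label_eq_of_circleOf_eq hu1, x'.1.label_eq_of_circleOf_eq hu2, hℓ]
        · exact (hC u hu).symm
      · rw [mul_zero]
      · rfl
  · -- different old states: no edge
    rw [if_neg (fun h ↦ hss (by rw [h]))]
    apply (G.bigon m tf ε).incidence_of_not_flip R hR tR
    rintro ⟨j, -, hs⟩
    apply hss
    rw [embO_state, x.state_eq] at hs
    have h1 : j = G.fC m tf ε := by
      by_contra hne
      have := congrFun hs (G.fC m tf ε)
      rw [Function.update_of_ne (fun h ↦ hne h.symm), stO_fC, stA_fC] at this
      exact Bool.noConfusion this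
    subst h1
    rw [update_stA_fC] at hs
    exact ((G.bigonState_inj m tf ε hs).1).symm

/-- The entries of the multiplication table on the row `(-) ⊗ 1`: the identity. [folklore] -/
theorem mergeCoeff_o_false (ℓ z : Bool) (hO : Bool) :
    (if hO then mergeCoeff R hR tR false ℓ z else mergeCoeff R hR tR ℓ false z) =
      if z = ℓ then 1 else 0 := by
  cases hO <;> cases ℓ <;> cases z <;> rfl

/-- The labels of `embO x o` at the two local strands of `g`: `o` on the strand on the small
circle, the label of `x` at the strand off it on the other. [folklore] -/
theorem embO_label_aG_bG (x : G.XA m tf ε) (o : Bool) :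
    ((embO x o).label (G.aG m tf ε), (embO x o).label (G.bG m tf ε)) =
      if G.InO m tf ε (G.aG m tf ε) then (o, x.1.label (G.cG m tf ε))
      else (x.1.label (G.cG m tf ε), o) := by
  unfold cG
  rcases G.inO_aG_bG m tf ε with ⟨ha, hb⟩ | ⟨ha, hb⟩
  · rw [if_neg ha, if_neg ha, embO_label_of_not_inO x o ha, embO_label_of_inO x o hb]
  · rw [if_pos ha, if_pos ha, embO_label_of_inO x o ha, embO_label_of_not_inO x o hb]

/-- **The block `Q → U` is the identity up to the Koszul sign.** For `x, x'` in the `A`-sector,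
`⟨d (embO x 1), embU x'⟩ = [x = x'] · edgeSign`: across the merge at `g` the multiplication by
the label `1` of the small circle is the identity. Khovanov (2000), §5.3, (4); Bar-Natan (2002),
§4.3. [cite: Khovanov2000, §5.3] -/
theorem incidence_embQ_embU (x x' : G.XA m tf ε) :
    (G.bigon m tf ε).incidence R hR tR (embO x false) (embU x') =
      if x = x' then (edgeSign (G.stO m tf ε (G.oldOf m tf ε x.1.state)) (G.gC m tf ε) : R) else 0 := by
  by_cases hss : G.oldOf m tf ε x.1.state = G.oldOf m tf ε x'.1.state
  · have hx : (embO x false).state = G.stO m tf ε (G.oldOf m tf ε x'.1.state) := by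
      rw [← hss]; exact embO_state x false
    have key := (G.isMergeAt_stO m tf ε (G.oldOf m tf ε x'.1.state)).incidence_push' hR tR
      (embO x false) hx ((embO x' false).lab (embO_state x' false)) (x'.1.label (G.cG m tf ε))
    change (G.bigon m tf ε).incidence R hR tR (embO x false) (embU x') = _ at key
    rw [update_stO_gC] at key
    rw [key]
    simp only [EnhancedState.lab_val]
    change (if ∀ u, (G.bigon m tf ε).circleOf (G.stU m tf ε (G.oldOf m tf ε x'.1.state)) u ≠
        (G.bigon m tf ε).circleOf (G.stU m tf ε (G.oldOf m tf ε x'.1.state)) (G.aG m tf ε) →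
        (embO x' false).label u = (embO x false).label u then
      (edgeSign (G.stO m tf ε (G.oldOf m tf ε x'.1.state)) (G.gC m tf ε) : R) *
        mergeCoeff R hR tR ((embO x false).label (G.aG m tf ε)) ((embO x false).label (G.bG m tf ε))
          (x'.1.label (G.cG m tf ε)) else 0) = _
    have tab : mergeCoeff R hR tR ((embO x false).label (G.aG m tf ε))
        ((embO x false).label (G.bG m tf ε)) (x'.1.label (G.cG m tf ε)) =
        if x'.1.label (G.cG m tf ε) = x.1.label (G.cG m tf ε) then 1 else 0 := by
      have hab := embO_label_aG_bG x false
      rw [← mergeCoeff_o_false hR tR (x.1.label (G.cG m tf ε)) (x'.1.label (G.cG m tf ε))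
        (decide (G.InO m tf ε (G.aG m tf ε)))]
      by_cases h : G.InO m tf ε (G.aG m tf ε)
      · rw [if_pos h] at hab
        simp only [Prod.mk.injEq] at hab
        rw [hab.1, hab.2]
        simp [h]
      · rw [if_neg h] at hab
        simp only [Prod.mk.injEq] at hab
        rw [hab.1, hab.2]
        simp [h]
    rw [tab, hss]
    by_cases hxx : x = x'
    · subst hxx
      rw [if_pos (fun u _ ↦ rfl), if_pos rfl, if_pos rfl, mul_one]
    · rw [if_neg hxx]
      split_ifs with hC hℓ
      · -- labels agree everywhere: `x = x'`
        exfalso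
        apply hxx
        apply Subtype.ext
        refine EnhancedState.ext'
          (x.state_eq.trans ((congrArg (G.stA m tf ε) hss).trans x'.state_eq.symm))
          (funext fun u ↦ ?_)
        by_cases hu : G.InO m tf ε u
        · -- on `O`: the labels of `x`, `x'` are those at `cF`, which is off `O`
          have e1 : x.1.label u = x.1.label (G.cF m tf ε) := x.1.label_eq_of_circleOf_eq (by
            rw [x.state_eq, circleOf_stA_cF]; exact G.circleOf_stA_eq_aF_of_inO m tf ε _ hu)
          have e2 : x'.1.label u = x'.1.label (G.cF m tf ε) := x'.1.label_eq_of_circleOf_eq (by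
            rw [x'.state_eq, circleOf_stA_cF]; exact G.circleOf_stA_eq_aF_of_inO m tf ε _ hu)
          rw [e1, e2]
          by_cases hc : (G.bigon m tf ε).circleOf (G.stU m tf ε (G.oldOf m tf ε x'.1.state)) (G.cF m tf ε) =
              (G.bigon m tf ε).circleOf (G.stU m tf ε (G.oldOf m tf ε x'.1.state)) (G.aG m tf ε)
          · -- `cF` on the merged circle, off `O`: same `stA`-circle as `cG`
            have r1 : ∀ y : G.XA m tf ε, G.oldOf m tf ε y.1.state = G.oldOf m tf ε x'.1.state →
                y.1.label (G.cF m tf ε) = y.1.label (G.cG m tf ε) := by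
              intro y hy
              rw [← embU_label_of_not_inO y (G.not_inO_cF m tf ε), embU_label, if_pos]
              rw [hy]; exact hc
            rw [r1 x hss, r1 x' rfl, hℓ]
          · have := hC _ hc
            rwa [embO_label_of_not_inO x' false (G.not_inO_cF m tf ε),
              embO_label_of_not_inO x false (G.not_inO_cF m tf ε), eq_comm] at this
        · by_cases hc : (G.bigon m tf ε).circleOf (G.stU m tf ε (G.oldOf m tf ε x'.1.state)) u =
              (G.bigon m tf ε).circleOf (G.stU m tf ε (G.oldOf m tf ε x'.1.state)) (G.aG m tf ε)
          · have r1 : ∀ y : G.XA m tf ε, G.oldOf m tf ε y.1.state = G.oldOf m tf ε x'.1.state →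
                y.1.label u = y.1.label (G.cG m tf ε) := by
              intro y hy
              rw [← embU_label_of_not_inO y hu, embU_label, if_pos]
              rw [hy]; exact hc
            rw [r1 x hss, r1 x' rfl, hℓ]
          · have := hC _ hc
            rwa [embO_label_of_not_inO x' false hu, embO_label_of_not_inO x false hu, eq_comm] at this
      · rw [mul_zero]
      · rfl
  · -- different old states: no edge
    rw [if_neg (fun h ↦ hss (by rw [h]))]
    apply (G.bigon m tf ε).incidence_of_not_flip R hR tR
    rintro ⟨j, -, hs⟩
    apply hss
    rw [embU_state, embO_state] at hs
    have h1 : j = G.gC m tf ε := by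
      by_contra hne
      have := congrFun hs (G.gC m tf ε)
      rw [Function.update_of_ne (fun h ↦ hne h.symm), stU_gC, stO_gC] at this
      exact Bool.noConfusion this
    subst h1
    rw [update_stO_gC] at hs
    exact ((G.bigonState_inj m tf ε hs).1).symm

/-- The block `A → P` has nonzero diagonal (over `ℤ`): used for the degrees. [folklore] -/
theorem incidence_embA_embP_self_ne_zero (x : G.XA m tf ε) :
    (G.bigon m tf ε).incidence ℤ 0 0 x.1 (embO x true) ≠ 0 := by
  rw [incidence_embA_embP, if_pos rfl]
  unfold edgeSign
  simp

/-- The block `Q → U` has nonzero diagonal (over `ℤ`). [folklore] -/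
theorem incidence_embQ_embU_self_ne_zero (x : G.XA m tf ε) :
    (G.bigon m tf ε).incidence ℤ 0 0 (embO x false) (embU x) ≠ 0 := by
  rw [incidence_embQ_embU, if_pos rfl]
  unfold edgeSign
  simp

end Ring

end GaussDiagram

end Literature.Topology.FourManifolds
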